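import Summits.CriticalPhenomena.PercolationContinuityZ3.Theorems.PercNearOneGluingNoHeavyLowerTailTwoPartitionOnePair
import HarnessLib.Audit

/-!
# `NoHeavyLowerTail` (crux stmt-CriticalPhenomena-4575), master-family hierarchy P3 (gen 31): the FOUR-TERM and the COUNTING form of the
# three-set antipodal functional (targets minus debts) and the faces they give for free

Support file (seat `prim-masterthm-p3`; `--supports stmt-CriticalPhenomena-4575`; memo
`run/shared/lean/prim/prim-masterthm/FROM-prim-masterthm-p3-g31-HALL-FORM.md`, HIERARCHY §38).  Companion of `…TwoPartitionThreeSet`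
(`threeSetN`, `ThreeSetAntipodal`), `…TwoPartitionKleitman` (`twoPartN`), `…TwoPartitionJuntaLift` (`chi`, `threeSetN_eq_sum`),
`…TwoPartitionOnePair` (`sum_eq_zero_of_compl_antisymm`).

(1) **FOUR-TERM FORM** (`threeSetN_eq_fourTerm`): with `Kl(𝒰,𝒱) := twoPartN 𝒰 𝒱 = #(𝒰 ∩ 𝒱) − #(𝒰 ∩ 𝒱ᶜˢ)` (two Harris–Kleitman slacks),
    `threeSetN 𝒜 ℬ 𝒞 = Kl(𝒜∩ℬ, 𝒜∩𝒞) + Kl(𝒜, ℬ∩𝒞) + #(𝒜∩ℬ∩𝒞 ∩ 𝒜ᶜˢ) − #(𝒜∩ℬ∩𝒞)`.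
(2) **COUNTING FORM** (`threeSetN_eq_card_sub`): `threeSetN 𝒜 ℬ 𝒞 = #(𝒜ℬ𝒞) − #(𝒜ℬ ∩ (𝒜𝒞)ᶜˢ) − #(𝒜 ∩ (ℬ𝒞 ∖ 𝒜)ᶜˢ)`, i.e.
    `ThreeSetAntipodal` says that the "debts" `{S ∈ 𝒜ℬ : Sᶜ ∈ 𝒜𝒞} ⊔ {S ∈ 𝒜 : Sᶜ ∈ ℬ𝒞 ∖ 𝒜}` are at most as many as the "targets" `𝒜ℬ𝒞`
    (with the antipodal coupling `ω' = ωᶜ`: `P(ω∈AB, ω'∈AC) + P(ω∈A, ω'∈BC∖A) ≤ P(ω∈ABC)`; the two events on the left are disjoint).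
(3) **FACES FOR FREE**: `0 ≤ threeSetN 𝒜 ℬ 𝒞` as soon as `#(𝒜 ∩ (ℬ𝒞∖𝒜)ᶜˢ) ≤ Kl(𝒜ℬ, 𝒜𝒞)` (`threeSetN_nonneg_of_card_le_twoPartN`); in particular
    whenever every member of `𝒜` whose complement lies in `ℬ ∩ 𝒞` has its complement in `𝒜` (`threeSetN_nonneg_of_inter_compls_subset`:
    `𝒜 ∩ (ℬ∩𝒞)ᶜˢ ⊆ 𝒜ᶜˢ`), which contains the known face `ℬ ∩ 𝒞 ⊆ 𝒜` and the NEW face "`𝒜` and `ℬ ∩ 𝒞` cross-intersecting" (no `S ∈ 𝒜`, `T ∈ ℬ∩𝒞`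
    disjoint; `threeSetN_nonneg_of_inter_compls_eq_empty'`).  The "inner half" is plain Kleitman (`card_inter_compls_union_le`:
    `#(𝒰 ∩ (𝒴∪𝒵)ᶜˢ) ≤ #(𝒰 ∩ 𝒴)` when `𝒰 ∩ 𝒴 = 𝒰 ∩ 𝒵`).
(4) The HALL FORM of the conjecture (an injection of the debts into the targets along `S ↦ φ S ⊇ S`, verified on `2^[n]`, `n ≤ 5`) and the
    reduction `ThreeSetHall → ThreeSetAntipodal` live in the companion file `…TwoPartitionHallForm` (it declares a `def`).
HONEST LABEL: identities and three easy faces; `ThreeSetAntipodal` remains OPEN. [this work]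
-/

namespace Summit.CriticalPhenomena.PercolationContinuityZ3.Theorems.TwoPartition

open Finset
open scoped FinsetFamily

variable {α : Type*} [DecidableEq α] [Fintype α]

/-! ### The four-term and the counting form -/

omit [Fintype α] in
/-- `χ² = χ`. [this work] -/
theorem chi_mul_self (𝒳 : Finset (Finset α)) (S : Finset α) : chi 𝒳 S * chi 𝒳 S = chi 𝒳 S := by
  unfold chi
  split_ifs <;> simp

/-- **Four-term form** (this work): `threeSetN 𝒜 ℬ 𝒞 = twoPartN (𝒜∩ℬ) (𝒜∩𝒞) + twoPartN 𝒜 (ℬ∩𝒞) + #(𝒜∩ℬ∩𝒞∩𝒜ᶜˢ) − #(𝒜∩ℬ∩𝒞)` —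
two Harris–Kleitman slacks, one "anti-Kleitman" count and a cardinality. [this work] -/
theorem threeSetN_eq_fourTerm (𝒜 ℬ 𝒞 : Finset (Finset α)) :
    threeSetN 𝒜 ℬ 𝒞 = twoPartN (𝒜 ∩ ℬ) (𝒜 ∩ 𝒞) + twoPartN 𝒜 (ℬ ∩ 𝒞) + #(𝒜 ∩ ℬ ∩ 𝒞 ∩ 𝒜ᶜˢ) - #(𝒜 ∩ ℬ ∩ 𝒞) := by
  rw [threeSetN_eq_sum, twoPartN_eq_sum, twoPartN_eq_sum, card_eq_sum_chi, card_eq_sum_chi, ← sub_eq_zero]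
  simp only [chi_inter, chi_compls, ← Finset.sum_add_distrib, ← Finset.sum_sub_distrib]
  refine Finset.sum_eq_zero fun S _ => ?_
  linear_combination (-(chi ℬ S * chi 𝒞 S)) * chi_mul_self 𝒜 S

/-- **Counting form** (this work): `threeSetN 𝒜 ℬ 𝒞 = #(𝒜∩ℬ∩𝒞) − #(𝒜∩ℬ ∩ (𝒜∩𝒞)ᶜˢ) − #(𝒜 ∩ ((ℬ∩𝒞) ∖ 𝒜)ᶜˢ)`: targets minus the two
kinds of debts (`S ∈ 𝒜ℬ` with `Sᶜ ∈ 𝒜𝒞`; `S ∈ 𝒜` with `Sᶜ ∈ ℬ𝒞 ∖ 𝒜`). [this work] -/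
theorem threeSetN_eq_card_sub (𝒜 ℬ 𝒞 : Finset (Finset α)) :
    threeSetN 𝒜 ℬ 𝒞 = (#(𝒜 ∩ ℬ ∩ 𝒞) : ℤ) - #(𝒜 ∩ ℬ ∩ (𝒜 ∩ 𝒞)ᶜˢ) - #(𝒜 ∩ ((ℬ ∩ 𝒞) \ 𝒜)ᶜˢ) := by
  rw [threeSetN_eq_sum, card_eq_sum_chi, card_eq_sum_chi, card_eq_sum_chi, ← sub_eq_zero]
  simp only [chi_inter, chi_compls, chi_sdiff, ← Finset.sum_sub_distrib]
  refine sum_eq_zero_of_compl_antisymm _ fun S => ?_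
  simp only [compl_compl]
  ring

/-! ### Faces for free -/

omit [Fintype α] in
/-- Intersections of up-sets are up-sets (coercion bookkeeping). [folklore] -/
theorem isUpperSet_inter' {𝒳 𝒴 : Finset (Finset α)} (h𝒳 : IsUpperSet (𝒳 : Set (Finset α)))
    (h𝒴 : IsUpperSet (𝒴 : Set (Finset α))) : IsUpperSet ((𝒳 ∩ 𝒴 : Finset (Finset α)) : Set (Finset α)) := by
  rw [coe_inter]; exact h𝒳.inter h𝒴

/-- **Sufficient condition** (this work): if the "outer debts" `{S ∈ 𝒜 : Sᶜ ∈ ℬ𝒞 ∖ 𝒜}` are at most the Harris–Kleitman slack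
`twoPartN (𝒜∩ℬ) (𝒜∩𝒞)`, then `0 ≤ threeSetN 𝒜 ℬ 𝒞`. [this work] -/
theorem threeSetN_nonneg_of_card_le_twoPartN {𝒜 ℬ 𝒞 : Finset (Finset α)}
    (h : (#(𝒜 ∩ ((ℬ ∩ 𝒞) \ 𝒜)ᶜˢ) : ℤ) ≤ twoPartN (𝒜 ∩ ℬ) (𝒜 ∩ 𝒞)) : 0 ≤ threeSetN 𝒜 ℬ 𝒞 := by
  rw [threeSetN_eq_card_sub]
  unfold twoPartN at h
  have e : 𝒜 ∩ ℬ ∩ (𝒜 ∩ 𝒞) = 𝒜 ∩ ℬ ∩ 𝒞 := by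
    ext S; simp only [mem_inter]; tauto
  rw [e] at h
  omega

/-- **Face** (this work): if every member of `𝒜` whose complement lies in `ℬ ∩ 𝒞` also has its complement in `𝒜`
(`𝒜 ∩ (ℬ∩𝒞)ᶜˢ ⊆ 𝒜ᶜˢ`), then `0 ≤ threeSetN 𝒜 ℬ 𝒞`.  Contains the known face `ℬ ∩ 𝒞 ⊆ 𝒜` and the cross-intersecting face below. [this work] -/
theorem threeSetN_nonneg_of_inter_compls_subset {𝒜 ℬ 𝒞 : Finset (Finset α)} (h𝒜 : IsUpperSet (𝒜 : Set (Finset α)))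
    (hℬ : IsUpperSet (ℬ : Set (Finset α))) (h𝒞 : IsUpperSet (𝒞 : Set (Finset α))) (h : 𝒜 ∩ (ℬ ∩ 𝒞)ᶜˢ ⊆ 𝒜ᶜˢ) :
    0 ≤ threeSetN 𝒜 ℬ 𝒞 := by
  refine threeSetN_nonneg_of_card_le_twoPartN ?_
  have h0 : 𝒜 ∩ ((ℬ ∩ 𝒞) \ 𝒜)ᶜˢ = ∅ := by
    refine eq_empty_of_forall_notMem fun S hS => ?_
    rw [mem_inter, mem_compls, mem_sdiff] at hS
    have h1 : S ∈ 𝒜 ∩ (ℬ ∩ 𝒞)ᶜˢ := mem_inter.2 ⟨hS.1, mem_compls.2 hS.2.1⟩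
    exact hS.2.2 (mem_compls.1 (h h1))
  rw [h0, card_empty, Nat.cast_zero]
  exact twoPartN_nonneg (isUpperSet_inter' h𝒜 hℬ) (isUpperSet_inter' h𝒜 h𝒞)

/-- **Cross-intersecting face** (this work, new): if every member of `𝒜` meets every member of `ℬ ∩ 𝒞` (equivalently, for up-sets,
`𝒜 ∩ (ℬ∩𝒞)ᶜˢ = ∅`), then `0 ≤ threeSetN 𝒜 ℬ 𝒞`. [this work] -/
theorem threeSetN_nonneg_of_inter_compls_eq_empty' {𝒜 ℬ 𝒞 : Finset (Finset α)} (h𝒜 : IsUpperSet (𝒜 : Set (Finset α)))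
    (hℬ : IsUpperSet (ℬ : Set (Finset α))) (h𝒞 : IsUpperSet (𝒞 : Set (Finset α))) (h : 𝒜 ∩ (ℬ ∩ 𝒞)ᶜˢ = ∅) :
    0 ≤ threeSetN 𝒜 ℬ 𝒞 :=
  threeSetN_nonneg_of_inter_compls_subset h𝒜 hℬ h𝒞 (by rw [h]; exact empty_subset _)

/-- **The inner half is Kleitman** (this work): if `𝒰 ∩ 𝒴 = 𝒰 ∩ 𝒵` for up-sets `𝒰, 𝒴, 𝒵`, then
`#{S ∈ 𝒰 : Sᶜ ∈ 𝒴 ∪ 𝒵} ≤ #(𝒰 ∩ 𝒴)` — Harris–Kleitman for `𝒰` and the up-set `𝒴 ∪ 𝒵`, whose trace on `𝒰` is `𝒰 ∩ 𝒴`. [this work] -/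
theorem card_inter_compls_union_le {𝒰 𝒴 𝒵 : Finset (Finset α)} (h𝒰 : IsUpperSet (𝒰 : Set (Finset α)))
    (h𝒴 : IsUpperSet (𝒴 : Set (Finset α))) (h𝒵 : IsUpperSet (𝒵 : Set (Finset α))) (h : 𝒰 ∩ 𝒴 = 𝒰 ∩ 𝒵) :
    #(𝒰 ∩ (𝒴 ∪ 𝒵)ᶜˢ) ≤ #(𝒰 ∩ 𝒴) := by
  have hYZ : IsUpperSet ((𝒴 ∪ 𝒵 : Finset (Finset α)) : Set (Finset α)) := by rw [coe_union]; exact h𝒴.union h𝒵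
  have k := twoPartN_nonneg h𝒰 hYZ
  unfold twoPartN at k
  have e : 𝒰 ∩ (𝒴 ∪ 𝒵) = 𝒰 ∩ 𝒴 := by rw [inter_union_distrib_left, ← h, union_idempotent]
  rw [e] at k
  omega

end Summit.CriticalPhenomena.PercolationContinuityZ3.Theorems.TwoPartition
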